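import Summits.QuantumFields.YangMills.Theorems.LuscherReductionRunningReductionTraceFormulaDefs
import Summits.QuantumFields.YangMills.Theorems.FemtoTransferGapAxisPermutation
import HarnessLib

/-!
# Two-insertion zero-flux thermal traces `Tr_phys(O K_β^m O K_β^{2L-m})` on the asymmetric torus `(ℤ/L)³ × (ℤ/2L)` — definitions

Defs module for the D-0145 LINE «SlowBitWindow» of seat ym-idea-4 (route onto `ThermalTraceWindow.SubFemtoFirstLevel`,
item stmt-QuantumFields-28291).  With the tree's closed kernel chain `TT.physTraceSucc` (`Z_phys(L, β, n+1) = Tr (P K_β)^{n+1}`, the seam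
`U_n → U_0` carrying the physical average `physAvg`), we insert a bounded observable `O` of the spatial links at time slices `0` and `m`:
`insTrace L β O m = ∫ (∏_{i<2L-1} K_β(U_i,U_{i+1})) · (P K_β(U_{2L-1}, ·))(U_0) · O(U_0) · O(U_m) dU` — for a gauge- and twist-invariant `O` this is
`Tr_{H_phys}(M_O T^m M_O T^{2L-m})`, `T = P K_β P` the zero-flux transfer operator, i.e. `Z_phys(2L) · ⟨O(0) O(m)⟩` in the zero-flux thermal state at
temperature `1/(2L)`.  `m = L` is the antipodal two-time correlation, `m = 1` the one-step autocorrelation.  Definitions only.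
[cite: MontvayMunster1994, (3.145)] [cite: Luscher1983, §2]
-/

set_option autoImplicit false

noncomputable section

open MeasureTheory
open Literature.MathematicalPhysics.QuantumFieldTheory
open Literature.MathematicalPhysics.QuantumLattice
open scoped BigOperators

namespace Summit.QuantumFields.YangMills.Theorems.FemtoTransferGap.TT

open Summit.QuantumFields.YangMills.Theorems.FemtoTransferGap

/-- **Two-insertion zero-flux thermal trace** on `2L` time slices: the closed chain of `2L` transfer kernels of `physTraceSucc L β (2L-1)`
with the observable `O` inserted at slices `0` and `m` (the slot `m` is read modulo `2L`; `m = 0` inserts `O²` at slice `0`).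
For physical `O` it equals `Tr_phys(M_O (PK_β)^m M_O (PK_β)^{2L-m})`. [cite: MontvayMunster1994, (3.145)] -/
def insTrace (L : ℕ) [NeZero L] (β : ℝ) (O : GaugeConfig 3 L SU2 → ℝ) (m : ℕ) : ℝ :=
  ∫ Us : Fin (2 * L - 1 + 1) → GaugeConfig 3 L SU2,
    (∏ i : Fin (2 * L - 1), transferKernel su2Rep β (Us i.castSucc) (Us i.succ)) *
      physAvg (transferKernel su2Rep β (Us (Fin.last (2 * L - 1)))) (Us 0) *
      (O (Us 0) * O (Us ⟨m % (2 * L - 1 + 1), Nat.mod_lt _ (Nat.succ_pos _)⟩))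
    ∂(Measure.pi fun _ : Fin (2 * L - 1 + 1) => configMeasure SU2 L)

end Summit.QuantumFields.YangMills.Theorems.FemtoTransferGap.TT

end
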